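import Summits.Schanuel.Schanuel.Theorems.RootDecomp1KXTop01

/-!
# RootDecomp1KXTop — lens 1, generation 45, node 4 (g45d) «SIMPLE POINTS OVER x = ∞, ALL x-DEGREES k, THE POINT (∞,∞) OF ANY ORDER e INCLUDED» (RULE K-R33 (iii); CLAIM L2301, ACK/price L2304, NODE L2313; critic VERDICT pending at staging — filed only on GO, behind XLinearII03) — continuation (RootDecomp1KXTop02): §XIII part 2

(lens-1 g45d HOME kernel K₄ = HOME/decomp-schanuel-lens-1/g45d/DLxtop.lean 5099 l = K₃ (tree: DegreeLadder + XLinear + XLinearII parts) + §XIII xiii_tail.lean 617 l (ns `…RootDecomp1KXTop`). Port by census-1 gen 19 as `RootDecomp1KXTop01–03` importing tree XLinearII03: the curves P = Σ_{j≤k} x^j c_j(Y) with separable top coefficient of maximal Y-degree (simple points over x = ∞) and the point (∞,∞) of any order e — `thinFibreAt_xPoly (k) (c) (e) …`, `thinFibreAt_xTop`, `thinFibreAt_xPoly_two`, `thinFibreAt_xLinear_sep_again`, `thinFibreAt_family`, positions (`mixed_not_affine`, `contact_not_*`) — ALL HYPOTHESIS-FREE (Ridout for rationals via the tree's XLinearII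 `ridout_window`, itself fed by `Ridout.finite_of_abs_le_one`).
PORT EDITS: the `(hR : PadicRothRat)` binder REMOVED from the five decls that carried it (the XLinearII port deleted `PadicRothRat`; `ridout_window`/`thinFibreAt_xPoly`/`thinFibreAt_xTop` are fed without it); `open …XLinearCore (norm_two …)` ↦ unrestricted open + private copies; linter option dropped; five docstrings added; statements and proofs otherwise verbatim. `--supports stmt-Schanuel-33364`; no census credit; rung 0.)
-/

noncomputable section

namespace Summit.Schanuel.Schanuel.Theorems.RootDecomp1KXTop

open Polynomial LiouvilleNumber
open scoped Nat
open Summit.Schanuel.Schanuel.Theorems.RootDecomp1KSkelCell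
  (exists_le_two_pow_factorial iota iota_spec iota_le_of_le pow_lt_of_lt_iota lt_iota_of_pow_lt iota_mono
   one_le_iota SkelLiouville SkelLiouvilleFix skelLiouville_iff_fix SkelLiouvilleFix.mono uStar dU rU dU_cast
   two_pow_le_four_mul_dU two_mul_dU_lt one_le_dU rU_den rU_cast uStar_sub_rU skelLiouvilleFix_one_uStar
   not_skelFixOne_algebraicIndependent)
open Summit.Schanuel.Schanuel.Theorems.RootDecomp1KTwoBaseCell (psNumer partialSum_eq_psNumer_div coprime_psNumer
  algebraicIndependent_of_forall_int')
open Summit.Schanuel.Schanuel.Theorems.RootDecomp1KRelLiouvilleCell (partialSum_two_strictMono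
  partialSum_two_lt_liouvilleNumber abs_liouvilleNumber_two_sub_partialSum)
open Summit.Schanuel.Schanuel.Theorems.RootDecomp1KDegreeLadder
open Summit.Schanuel.Schanuel.Theorems.RootDecomp1KXLinearCore
open Summit.Schanuel.Schanuel.Theorems.RootDecomp1KXLinear
open Summit.Schanuel.Schanuel.Theorems.RootDecomp1KXLinearII

/-- the same dichotomy when `c_k` is a non-zero CONSTANT (`deg c_k = 0`): only the `(∞, ∞)` alternative occurs. -/
theorem at_infinity_of_const_top (k : ℕ) (c : ℕ → ℤ[X]) (e : ℕ) (hB : c k ≠ 0) (hd : (c k).natDegree = 0)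
    (hdeg : ∀ j, j < k → (c j).natDegree ≤ (c k).natDegree + e) :
    ∃ N₁ : ℕ, ∀ N, N₁ ≤ N → ∀ r : ℚ, bev (xPolyP k c) (partialSum 2 N) r = 0 →
      1 ≤ e ∧ ‖((c k).leadingCoeff : PadicAlgCl 2)‖ * 2 ^ N ! ≤ ‖(r : PadicAlgCl 2)‖ ^ e := by
  set ℓ : PadicAlgCl 2 := ((c k).leadingCoeff : PadicAlgCl 2) with hℓdef
  have hℓpos : 0 < ‖ℓ‖ := by rw [norm_pos_iff, hℓdef]; exact_mod_cast leadingCoeff_ne_zero.mpr hB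
  obtain ⟨N₁, hN₁⟩ := exists_pow_lt_of_lt_one hℓpos (show (1 / 2 : ℝ) < 1 by norm_num)
  refine ⟨max N₁ 3, fun N hN r hP => ?_⟩
  have hN3 : 3 ≤ N := le_trans (le_max_right _ _) hN
  have hNN₁ : N₁ ≤ N := le_trans (le_max_left _ _) hN
  have hdom := top_coeff_small k c e hdeg hN3 r hP
  have hC : c k = Polynomial.C ((c k).coeff 0) := eq_C_of_natDegree_eq_zero hd
  have hval : aeval (r : PadicAlgCl 2) (c k) = ℓ := by
    rw [hℓdef, leadingCoeff, hd]
    conv_lhs => rw [hC]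
    rw [aeval_C]
    exact eq_intCast _ _
  rw [hval, hd, zero_add] at hdom
  have h2pos : (0 : ℝ) < 2 ^ N ! := by positivity
  have hhalf : (1 / 2 : ℝ) ^ N ! * 2 ^ N ! = 1 := by
    rw [div_pow, one_pow, div_mul_cancel₀ _ (ne_of_gt h2pos)]
  have h3 : ‖ℓ‖ * 2 ^ N ! ≤ max 1 ‖(r : PadicAlgCl 2)‖ ^ e := by
    have := mul_le_mul_of_nonneg_right hdom h2pos.le
    calc ‖ℓ‖ * 2 ^ N ! ≤ (1 / 2 : ℝ) ^ N ! * max 1 ‖(r : PadicAlgCl 2)‖ ^ e * 2 ^ N ! := this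
      _ = max 1 ‖(r : PadicAlgCl 2)‖ ^ e := by
          rw [mul_comm, ← mul_assoc, mul_comm (2 ^ N ! : ℝ), hhalf, one_mul]
  have h4 : (1 / 2 : ℝ) ^ N ! ≤ (1 / 2 : ℝ) ^ N₁ :=
    pow_le_pow_of_le_one (by norm_num) (by norm_num) (hNN₁.trans (Nat.self_le_factorial N))
  -- `‖ℓ‖·2^{N!} > 1` for `N ≥ N₁`
  have hbig : 1 < ‖ℓ‖ * 2 ^ N ! := by
    have h5 : (1 / 2 : ℝ) ^ N ! < ‖ℓ‖ := lt_of_le_of_lt h4 hN₁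
    have := mul_lt_mul_of_pos_right h5 h2pos
    rwa [hhalf] at this
  have he : 1 ≤ e := by
    by_contra he
    have he0 : e = 0 := by omega
    rw [he0, pow_zero] at h3
    linarith
  refine ⟨he, ?_⟩
  -- `max 1 ‖r‖ = ‖r‖`, since `max 1 ‖r‖ ^ e > 1`
  rcases le_or_gt ‖(r : PadicAlgCl 2)‖ 1 with hr1 | hr1
  · rw [max_eq_left hr1, one_pow] at h3
    linarith
  · rwa [max_eq_right hr1.le] at h3

/-! ### The point `(∞, ∞)`: a 2-adically large rational has a large denominator -/

/-- `‖r‖₂ ≤ den(r)`. -/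
theorem norm_ratCast_le_den (r : ℚ) : ‖(r : PadicAlgCl 2)‖ ≤ r.den := by
  rcases eq_or_ne r 0 with rfl | hr
  · simp
  rw [norm_ratCast_two hr, padicValRat_def]
  have hv : -((padicValInt 2 r.num : ℤ) - (padicValNat 2 r.den : ℤ)) ≤ (padicValNat 2 r.den : ℤ) := by
    have : (0 : ℤ) ≤ (padicValInt 2 r.num : ℤ) := by positivity
    omega
  calc (2 : ℝ) ^ (-((padicValInt 2 r.num : ℤ) - (padicValNat 2 r.den : ℤ)))
      ≤ (2 : ℝ) ^ (padicValNat 2 r.den : ℤ) := zpow_le_zpow_right₀ (by norm_num) hv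
    _ = ((2 ^ padicValNat 2 r.den : ℕ) : ℝ) := by rw [zpow_natCast]; push_cast; ring
    _ ≤ r.den := by exact_mod_cast Nat.le_of_dvd r.den_pos pow_padicValNat_dvd

/-- an eventual inequality: `G^{N+1} ≤ 2^{(N−a)·N!}` for `N` large. -/
theorem eventually_pow_le' (G : ℝ) (a : ℕ) : ∃ N₂ : ℕ, ∀ N, N₂ ≤ N → G ^ (N + 1) ≤ (2 : ℝ) ^ ((N - a) * N !) := by
  obtain ⟨m, hm⟩ : ∃ m : ℕ, |G| ≤ 2 ^ m := by
    obtain ⟨m, hm⟩ := exists_nat_ge |G|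
    exact ⟨m, hm.trans (by exact_mod_cast (Nat.lt_two_pow_self).le)⟩
  refine ⟨m + a + 3, fun N hN => ?_⟩
  have h0 : G ^ (N + 1) ≤ |G| ^ (N + 1) := by rw [← abs_pow]; exact le_abs_self _
  refine h0.trans ?_
  calc |G| ^ (N + 1) ≤ (2 ^ m) ^ (N + 1) := pow_le_pow_left₀ (abs_nonneg G) hm _
    _ = 2 ^ (m * (N + 1)) := by rw [pow_mul]
    _ ≤ 2 ^ ((N - a) * N !) := by
        apply pow_le_pow_right₀ (by norm_num)
        have h1 : m * (N + 1) ≤ (m + 3) * N := by nlinarith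
        have h2 : (m + 3) * N ≤ (N - a) * N := Nat.mul_le_mul_right _ (by omega)
        exact h1.trans (h2.trans (Nat.mul_le_mul_left _ (Nat.self_le_factorial N)))

set_option maxHeartbeats 400000 in
/-- **the arithmetic at `(∞, ∞)`**: `ℓ·2^{N!} ≤ d^e` (`ℓ > 0` fixed) forces `C·2^{(N+1)!} < d^{(e+1)N}` for `N` large. -/
theorem infinity_arith (ℓ C : ℝ) (hℓ : 0 < ℓ) (e : ℕ) : ∃ N₂ : ℕ, ∀ N, N₂ ≤ N → ∀ d : ℕ, 1 ≤ d →
    ℓ * 2 ^ N ! ≤ (d : ℝ) ^ e → C * 2 ^ (N + 1)! < (d : ℝ) ^ ((e + 1) * N) := by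
  set G : ℝ := max 1 (C ^ e) * max 1 ((1 / ℓ) ^ (e + 1)) with hG
  have hG1 : 1 ≤ max 1 ((1 / ℓ) ^ (e + 1)) := le_max_left _ _
  have hC1 : 1 ≤ max 1 (C ^ e) := le_max_left _ _
  obtain ⟨N₂, hN₂⟩ := eventually_pow_le' G (e + 1)
  refine ⟨max N₂ (e + 1), fun N hN d hd hx => ?_⟩
  have hNN₂ : N₂ ≤ N := le_trans (le_max_left _ _) hN
  have hNe : e + 1 ≤ N := le_trans (le_max_right _ _) hN
  have hdR : (1 : ℝ) ≤ d := by exact_mod_cast hd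
  set W : ℝ := 2 ^ N ! with hW
  have hWpos : 0 < W := by positivity
  have hW1 : 1 < W := by
    rw [hW]; exact one_lt_pow₀ (by norm_num) (Nat.factorial_pos N).ne'
  have hfact : (2 : ℝ) ^ (N + 1)! = W ^ (N + 1) := by
    rw [hW, ← pow_mul]; congr 1; rw [Nat.factorial_succ, mul_comm]
  rw [hfact]
  by_contra hle
  push Not at hle
  obtain ⟨t, rfl⟩ : ∃ t, N = t + e := ⟨N - e, by omega⟩
  have ht1 : 1 ≤ t := by omega
  -- `(ℓ W)^{(e+1)N} ≤ (d^e)^{(e+1)N} = (d^{(e+1)N})^e ≤ (C W^{N+1})^e`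
  have h1 : (ℓ * W) ^ ((e + 1) * (t + e)) ≤ ((d : ℝ) ^ e) ^ ((e + 1) * (t + e)) :=
    pow_le_pow_left₀ (by positivity) hx _
  have h2 : ((d : ℝ) ^ e) ^ ((e + 1) * (t + e)) ≤ (C * W ^ (t + e + 1)) ^ e := by
    rw [← pow_mul, mul_comm e, pow_mul]
    exact pow_le_pow_left₀ (by positivity) hle _
  have hL : (ℓ * W) ^ ((e + 1) * (t + e)) = ℓ ^ ((e + 1) * (t + e)) * W ^ t * W ^ (e * (t + e + 1)) := by
    rw [mul_pow, mul_assoc, ← pow_add]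
    congr 2; ring
  have hR : (C * W ^ (t + e + 1)) ^ e = C ^ e * W ^ (e * (t + e + 1)) := by
    rw [mul_pow, ← pow_mul, mul_comm (t + e + 1) e]
  have h12 : ℓ ^ ((e + 1) * (t + e)) * W ^ t * W ^ (e * (t + e + 1)) ≤ C ^ e * W ^ (e * (t + e + 1)) := by
    rw [← hL, ← hR]; exact h1.trans h2
  have hWe : 0 < W ^ (e * (t + e + 1)) := by positivity
  have h3 : ℓ ^ ((e + 1) * (t + e)) * W ^ t ≤ C ^ e := le_of_mul_le_mul_right h12 hWe
  -- `W^t ≤ C^e · (1/ℓ)^{(e+1)N} ≤ G^{N+1}`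
  have hℓpow : 0 < ℓ ^ ((e + 1) * (t + e)) := by positivity
  have h4a : W ^ t ≤ C ^ e * (1 / ℓ) ^ ((e + 1) * (t + e)) := by
    rw [one_div, inv_pow, ← div_eq_mul_inv, le_div_iff₀ hℓpow]
    linarith [h3]
  have hBB : (1 / ℓ) ^ ((e + 1) * (t + e)) ≤ (max 1 ((1 / ℓ) ^ (e + 1))) ^ (t + e + 1) := by
    rcases le_or_gt (1 / ℓ) 1 with hs | hs
    · exact (pow_le_one₀ (by positivity) hs).trans (one_le_pow₀ hG1)
    · calc (1 / ℓ) ^ ((e + 1) * (t + e)) ≤ (1 / ℓ) ^ ((e + 1) * (t + e + 1)) :=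
            pow_le_pow_right₀ hs.le (by nlinarith)
        _ = ((1 / ℓ) ^ (e + 1)) ^ (t + e + 1) := by rw [← pow_mul]
        _ ≤ (max 1 ((1 / ℓ) ^ (e + 1))) ^ (t + e + 1) :=
            pow_le_pow_left₀ (by positivity) (le_max_right _ _) _
  have h4 : W ^ t ≤ G ^ (t + e + 1) := by
    refine h4a.trans ?_
    calc C ^ e * (1 / ℓ) ^ ((e + 1) * (t + e))
        ≤ max 1 (C ^ e) * (max 1 ((1 / ℓ) ^ (e + 1))) ^ (t + e + 1) :=
          mul_le_mul (le_max_right _ _) hBB (by positivity) (by positivity)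
      _ ≤ (max 1 (C ^ e)) ^ (t + e + 1) * (max 1 ((1 / ℓ) ^ (e + 1))) ^ (t + e + 1) := by
          refine mul_le_mul_of_nonneg_right (le_self_pow₀ hC1 (by omega)) (by positivity)
      _ = G ^ (t + e + 1) := by rw [hG, mul_pow]
  have h5 : G ^ (t + e + 1) ≤ (2 : ℝ) ^ ((t + e - (e + 1)) * (t + e)!) := hN₂ (t + e) hNN₂
  have h6 : (2 : ℝ) ^ ((t + e - (e + 1)) * (t + e)!) = W ^ (t - 1) := by
    rw [hW, ← pow_mul]; congr 1
    have : t + e - (e + 1) = t - 1 := by omega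
    rw [this, mul_comm]
  have h7 : W ^ (t - 1) < W ^ t := pow_lt_pow_right₀ hW1 (by omega)
  rw [h6] at h5
  linarith

/-! ### The theorem -/

/-- (γ) a rational root `r` of `c_k` in the window is itself a Ridout point (`β := r`). -/
theorem root_mem_window (k : ℕ) (c : ℕ → ℤ[X]) (C : ℝ) (r : ℚ) (hr : |(r : ℝ)| ≤ C)
    (hroot : aeval (r : PadicAlgCl 2) (c k) = 0) :
    r ∈ {r : ℚ | |(r : ℝ)| ≤ C ∧ ∃ β : PadicAlgCl 2, aeval β (c k) = 0 ∧
      (r.den : ℝ) ^ 5 * ‖((c k).leadingCoeff : PadicAlgCl 2) * ((r : PadicAlgCl 2) - β)‖ ^ 2 ≤ 1} :=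
  ⟨hr, (r : PadicAlgCl 2), hroot, by simp⟩

end Summit.Schanuel.Schanuel.Theorems.RootDecomp1KXTop

end
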